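import Literature.NumberTheory.Transcendental.BakerModels
import HarnessLib

/-!
# The entries of the Siegel system of Baker's method on `M_κ`: explicit arithmetic bounds

Topic: `Literature/NumberTheory/Transcendental`. Plan item W4/S4 (third sub-brick) of the unit
`provefact-Literature.NumberTheory.Transcendental.H-b596640137`. With the field `K` and the
`K`-models of `BakerField.lean` / `BakerModels.lean` we form, for the auxiliary form
`P = ∑_ν p_ν · homogMonomial D ν` (`LineJetArith.lean`), the numbers whose vanishing forces
`VanishesAlong 𝔟 F_P (s·v) T` (`LineJetForms.vanishesAlong_span_of_wordForms`,
`LineODEModel.wordForm_eq_map`):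

`entryVal s ω ν = (W^{(s)}_ω (homogMonomial D ν ∘ HK^{(s)}))(gK s) ∈ K`,

`W^{(s)}` the words in the `K`-derivations of the adapted chart `c_s` at `s·v`. PROVED here:

* uniform constants `qB` (`‖QK‖_σ ≤ qB`), `hB ≥ 1` (`‖HK‖_σ ≤ hB`), `hdeg` (`deg HK ≤ hdeg`), as
  finite sums / suprema over embeddings, chart choices and indices;
* `Fν_bounds` — the substituted monomial `F_ν = homogMonomial D ν ∘ HK` has `deg ≤ D·hdeg`,
  `‖F_ν‖_σ ≤ hB^D`, `d₁^{2D} F_ν` integral (`|ν| ≤ D`);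
* `entryVal_bounds` — for `s`, a word `ω` of length `k` and `|ν| ≤ D`: with `d_s = d₁^{s+1}`,
  `|σ(entryVal)| ≤ (D hdeg + 2k)^k qB^k hB^D ((s+1) M^{s+1})^{D hdeg + 2k}` for all `σ`, and
  `d_s^{2D + 3k + D hdeg + 2k} · entryVal ∈ 𝓞_K` (`ArithPoly.word_eval_bounds`).

These are the "`(6.18)`–`(6.19)`"-type estimates of Baker–Wüstholz §6.8 in the present setting;
the application of Siegel's lemma follows in the sequel.

## References

* A. Baker, G. Wüstholz, *Logarithmic Forms and Diophantine Geometry*, CUP 2007, §6.8.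
-/

noncomputable section

open Complex MvPolynomial Finset
open Literature.NumberTheory.Transcendental.ArithPoly
open Literature.NumberTheory.Transcendental.Chudnovsky
open scoped PeriodPair

namespace Literature.NumberTheory.Transcendental

namespace ArithPoly

variable {K : Type*} [Field K] {ι : Type*}

/-- Products over finite sets with varying exponents. [folklore] -/
theorem IsDenInt.prod' {α : Type*} {d : ℤ} (s : Finset α) {e : α → ℕ} {F : α → MvPolynomial ι K}
    (h : ∀ a ∈ s, IsDenInt d (e a) (F a)) : IsDenInt d (∑ a ∈ s, e a) (∏ a ∈ s, F a) := by
  classical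
  induction s using Finset.induction_on with
  | empty => simpa using IsDenInt.one (ι := ι) (K := K) d
  | insert a s ha ih =>
    rw [Finset.prod_insert ha, Finset.sum_insert ha]
    exact (h a (Finset.mem_insert_self a s)).mul (ih fun b hb => h b (Finset.mem_insert_of_mem hb))

end ArithPoly

namespace GaGmE

namespace Std

namespace BakerData

variable {β γ δ : Type} [Fintype β] [Fintype γ] [Fintype δ] [DecidableEq γ]
variable (B : BakerData β γ δ)

/-! ### Uniform constants -/

/-- `‖·‖_σ 1 = 1` for the pullback seminorms. [folklore] -/
theorem embSeminorm_one_le (σ : B.K →+* ℂ) : embSeminorm σ 1 ≤ 1 := by simp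

/-- **A uniform bound for the sizes of the derivation data**:
`qB = ∑_{σ,c,m,i} ‖QK c m i‖_σ`. [folklore] -/
def qB : ℝ := ∑ σ : B.K →+* ℂ, ∑ c : γ → Bool, ∑ m : Fin B.dd, ∑ i : Gen β γ δ, wnorm (embSeminorm σ) (B.QK c m i)

/-- `qB ≥ 0`. [folklore] -/
theorem qB_nonneg : 0 ≤ B.qB :=
  Finset.sum_nonneg fun _ _ => Finset.sum_nonneg fun _ _ => Finset.sum_nonneg fun _ _ =>
    Finset.sum_nonneg fun _ _ => wnorm_nonneg _ _

/-- `‖QK c m i‖_σ ≤ qB`. [folklore] -/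
theorem wnorm_QK_le (σ : B.K →+* ℂ) (c : γ → Bool) (m : Fin B.dd) (i : Gen β γ δ) :
    wnorm (embSeminorm σ) (B.QK c m i) ≤ B.qB := by
  unfold qB
  refine le_trans ?_ (single_le_sum (f := fun σ' : B.K →+* ℂ => ∑ c : γ → Bool, ∑ m : Fin B.dd,
    ∑ i : Gen β γ δ, wnorm (embSeminorm σ') (B.QK c m i))
    (fun _ _ => Finset.sum_nonneg fun _ _ => Finset.sum_nonneg fun _ _ =>
      Finset.sum_nonneg fun _ _ => wnorm_nonneg _ _) (mem_univ σ))
  refine le_trans ?_ (single_le_sum (f := fun c' : γ → Bool => ∑ m : Fin B.dd,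
    ∑ i : Gen β γ δ, wnorm (embSeminorm σ) (B.QK c' m i))
    (fun _ _ => Finset.sum_nonneg fun _ _ => Finset.sum_nonneg fun _ _ => wnorm_nonneg _ _) (mem_univ c))
  refine le_trans ?_ (single_le_sum (f := fun m' : Fin B.dd =>
    ∑ i : Gen β γ δ, wnorm (embSeminorm σ) (B.QK c m' i))
    (fun _ _ => Finset.sum_nonneg fun _ _ => wnorm_nonneg _ _) (mem_univ m))
  exact single_le_sum (f := fun i' => wnorm (embSeminorm σ) (B.QK c m i')) (fun _ _ => wnorm_nonneg _ _)
    (mem_univ i)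

/-- **A uniform bound for the sizes of the chart polynomials**: `hB = 1 + ∑_{σ,c,J} ‖HK c J‖_σ`.
[folklore] -/
def hB : ℝ := 1 + ∑ σ : B.K →+* ℂ, ∑ c : γ → Bool, ∑ J : Option β × ThetaIdx γ δ, wnorm (embSeminorm σ) (B.HK c J)

/-- `1 ≤ hB`. [folklore] -/
theorem one_le_hB : 1 ≤ B.hB := by
  unfold hB
  have : 0 ≤ ∑ σ : B.K →+* ℂ, ∑ c : γ → Bool, ∑ J : Option β × ThetaIdx γ δ,
      wnorm (embSeminorm σ) (B.HK c J) :=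
    Finset.sum_nonneg fun _ _ => Finset.sum_nonneg fun _ _ => Finset.sum_nonneg fun _ _ => wnorm_nonneg _ _
  linarith

/-- `‖HK c J‖_σ ≤ hB`. [folklore] -/
theorem wnorm_HK_le (σ : B.K →+* ℂ) (c : γ → Bool) (J : Option β × ThetaIdx γ δ) :
    wnorm (embSeminorm σ) (B.HK c J) ≤ B.hB := by
  unfold hB
  have h1 : wnorm (embSeminorm σ) (B.HK c J) ≤ ∑ σ' : B.K →+* ℂ, ∑ c' : γ → Bool,
      ∑ J' : Option β × ThetaIdx γ δ, wnorm (embSeminorm σ') (B.HK c' J') := by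
    refine le_trans ?_ (single_le_sum (f := fun σ' : B.K →+* ℂ => ∑ c' : γ → Bool,
      ∑ J' : Option β × ThetaIdx γ δ, wnorm (embSeminorm σ') (B.HK c' J'))
      (fun _ _ => Finset.sum_nonneg fun _ _ => Finset.sum_nonneg fun _ _ => wnorm_nonneg _ _) (mem_univ σ))
    refine le_trans ?_ (single_le_sum (f := fun c' : γ → Bool =>
      ∑ J' : Option β × ThetaIdx γ δ, wnorm (embSeminorm σ) (B.HK c' J'))
      (fun _ _ => Finset.sum_nonneg fun _ _ => wnorm_nonneg _ _) (mem_univ c))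
    exact single_le_sum (f := fun J' => wnorm (embSeminorm σ) (B.HK c J')) (fun _ _ => wnorm_nonneg _ _)
      (mem_univ J)
  linarith

/-- **A uniform bound for the degrees of the chart polynomials.** [folklore] -/
def hdeg : ℕ := Finset.univ.sup fun cJ : (γ → Bool) × (Option β × ThetaIdx γ δ) => (B.HK cJ.1 cJ.2).totalDegree

/-- `deg HK c J ≤ hdeg`. [folklore] -/
theorem totalDegree_HK_le (c : γ → Bool) (J : Option β × ThetaIdx γ δ) : (B.HK c J).totalDegree ≤ B.hdeg :=
  Finset.le_sup (f := fun cJ : (γ → Bool) × (Option β × ThetaIdx γ δ) => (B.HK cJ.1 cJ.2).totalDegree)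
    (mem_univ (c, J))

/-! ### The substituted monomials `F_ν` -/

/-- `F_ν = homogMonomial D ν ∘ HK c` over `K`. [folklore] -/
def Fν (c : γ → Bool) (D : ℕ) (ν : β ⊕ (γ ⊕ δ) →₀ ℕ) : MvPolynomial (Gen β γ δ) B.K :=
  bind₁ (B.HK c) (homogMonomialᵣ D ν)

/-- The product formula for `F_ν` (with `μ = ν ∘ affIdx⁻¹`, `|μ| = |ν|`). [folklore] -/
theorem Fν_eq (c : γ → Bool) (D : ℕ) (ν : β ⊕ (γ ⊕ δ) →₀ ℕ) :
    B.Fν c D ν = B.HK c (baseIdx (genericChart (γ := γ))) ^ (D - ν.degree) *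
      ∏ i ∈ (ν.mapDomain affIdx).support, B.HK c i ^ (ν.mapDomain affIdx) i := by
  rw [Fν, homogMonomialᵣ, map_mul, map_pow, bind₁_X_right, bind₁_monomial, C_1, one_mul]

omit [Fintype β] [Fintype γ] [Fintype δ] in
/-- `|ν ∘ affIdx⁻¹| = |ν|`. [folklore] -/
theorem degree_mapDomain_affIdx (ν : β ⊕ (γ ⊕ δ) →₀ ℕ) :
    (ν.mapDomain (affIdx (β := β) (γ := γ) (δ := δ))).degree = ν.degree :=
  Finsupp.degree_mapDomain _ _

omit [Fintype β] [Fintype γ] [Fintype δ] [DecidableEq γ] in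
/-- The degree is the sum of the exponents over the support. [folklore] -/
theorem degree_eq_sum_support {α : Type*} (μ : α →₀ ℕ) : μ.degree = ∑ i ∈ μ.support, μ i := by
  rw [Finsupp.degree]; rfl

/-- **Bounds for `F_ν`**: for `|ν| ≤ D`, `deg F_ν ≤ D·hdeg`, `‖F_ν‖_σ ≤ hB^D`, `d₁^{2D} F_ν` integral.
[folklore] -/
theorem Fν_bounds (σ : B.K →+* ℂ) (c : γ → Bool) {D : ℕ} {ν : β ⊕ (γ ⊕ δ) →₀ ℕ} (hν : ν.degree ≤ D) :
    (B.Fν c D ν).totalDegree ≤ D * B.hdeg ∧ wnorm (embSeminorm σ) (B.Fν c D ν) ≤ B.hB ^ D ∧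
      IsDenInt B.d₁ (2 * D) (B.Fν c D ν) := by
  set μ := ν.mapDomain (affIdx (β := β) (γ := γ) (δ := δ)) with hμ
  have hμdeg : ∑ i ∈ μ.support, μ i = ν.degree := by
    rw [← degree_eq_sum_support, hμ, degree_mapDomain_affIdx]
  have hsplit : D - ν.degree + ν.degree = D := Nat.sub_add_cancel hν
  have h1 := B.embSeminorm_one_le σ
  have hB1 := B.one_le_hB
  rw [Fν_eq]
  refine ⟨?_, ?_, ?_⟩
  · -- degree
    refine (totalDegree_mul _ _).trans ?_
    have hA : (B.HK c (baseIdx genericChart) ^ (D - ν.degree)).totalDegree ≤ (D - ν.degree) * B.hdeg :=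
      (totalDegree_pow _ _).trans (Nat.mul_le_mul_left _ (B.totalDegree_HK_le _ _))
    have hP : (∏ i ∈ μ.support, B.HK c i ^ μ i).totalDegree ≤ ν.degree * B.hdeg := by
      refine (totalDegree_finsetProd _ _).trans ?_
      rw [← hμdeg, Finset.sum_mul]
      refine Finset.sum_le_sum fun i _ => ?_
      exact (totalDegree_pow _ _).trans (Nat.mul_le_mul_left _ (B.totalDegree_HK_le _ _))
    calc _ ≤ (D - ν.degree) * B.hdeg + ν.degree * B.hdeg := add_le_add hA hP
      _ = D * B.hdeg := by rw [← add_mul, hsplit]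
  · -- size
    refine (wnorm_mul_le _ _ _).trans ?_
    have hA : wnorm (embSeminorm σ) (B.HK c (baseIdx genericChart) ^ (D - ν.degree)) ≤ B.hB ^ (D - ν.degree) :=
      (wnorm_pow_le _ h1 _ _).trans (pow_le_pow_left₀ (wnorm_nonneg _ _) (B.wnorm_HK_le _ _ _) _)
    have hP : wnorm (embSeminorm σ) (∏ i ∈ μ.support, B.HK c i ^ μ i) ≤ B.hB ^ ν.degree := by
      refine (wnorm_prod_le _ h1 _ _).trans ?_
      rw [← hμdeg, ← Finset.prod_pow_eq_pow_sum]
      refine Finset.prod_le_prod (fun i _ => wnorm_nonneg _ _) fun i _ => ?_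
      exact (wnorm_pow_le _ h1 _ _).trans (pow_le_pow_left₀ (wnorm_nonneg _ _) (B.wnorm_HK_le _ _ _) _)
    calc _ ≤ B.hB ^ (D - ν.degree) * B.hB ^ ν.degree :=
          mul_le_mul hA hP (wnorm_nonneg _ _) (pow_nonneg (zero_le_one.trans hB1) _)
      _ = B.hB ^ D := by rw [← pow_add, hsplit]
  · -- denominators
    have hA : IsDenInt B.d₁ ((D - ν.degree) * 2) (B.HK c (baseIdx genericChart) ^ (D - ν.degree)) :=
      (B.isDenInt_HK c _).pow _
    have hP : IsDenInt B.d₁ (∑ i ∈ μ.support, μ i * 2) (∏ i ∈ μ.support, B.HK c i ^ μ i) :=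
      IsDenInt.prod' _ fun i _ => (B.isDenInt_HK c i).pow _
    have := hA.mul hP
    rw [← Finset.sum_mul, hμdeg, ← add_mul, hsplit, mul_comm] at this
    exact this

/-! ### The entries and their bounds -/

/-- The adapted chart at `s·v`. [folklore] -/
def cAt (s : ℕ) : γ → Bool := chartChoiceAt B.L ((s : ℂ) • B.v)

/-- The `K`-derivations of the adapted chart at `s·v` along the directions. [folklore] -/
def DK (s : ℕ) (m : Fin B.dd) : MvPolynomial (Gen β γ δ) B.K →ₗ[B.K] MvPolynomial (Gen β γ δ) B.K :=
  (mkDerivation B.K (B.QK (B.cAt s) m)).toLinearMap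

/-- **The entries of the Siegel system**: `entryVal s ω ν = (W^{(s)}_ω F_ν)(gK s)`.
[cite: BakerWustholz2007, §6.8] -/
def entryVal (s : ℕ) {k : ℕ} (ω : Fin k → Fin B.dd) (D : ℕ) (ν : β ⊕ (γ ⊕ δ) →₀ ℕ) : B.K :=
  MvPolynomial.eval (B.gK s) (PolyODE.wordApp (B.DK s) ω (B.Fν (B.cAt s) D ν))

/-- The working denominator at `s·v`: `d_s = d₁^{s+1}`. [folklore] -/
def dAt (s : ℕ) : ℤ := B.d₁ ^ (s + 1)

/-- `d₁ ∣ d_s`. [folklore] -/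
theorem d₁_dvd_dAt (s : ℕ) : B.d₁ ∣ B.dAt s := dvd_pow_self _ (Nat.succ_ne_zero s)

/-- `d_s · gK s i ∈ 𝓞_K`. [folklore] -/
theorem isIntegral_dAt_mul_gK (s : ℕ) (i : Gen β γ δ) : B.IntZ ((B.dAt s : B.K) * B.gK s i) := by
  have h := B.isIntegral_den_pow_mul_gK s i
  have e : ((B.dAt s : ℤ) : B.K) * B.gK s i = (2 : B.K) ^ (s + 1) * ((B.den : B.K) ^ (s + 1) * B.gK s i) := by
    simp only [dAt, d₁, Int.cast_pow, Int.cast_mul, Int.cast_ofNat]; ring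
  have h2 : B.IntZ ((2 : B.K) ^ (s + 1)) := by
    have := (isIntegral_intCast (B := B.K) 2).pow (s + 1)
    simpa using this
  show IsIntegral ℤ _
  rw [e]
  exact h2.mul h

/-- **Bounds for the entries**: for a word `ω` of length `k` and `|ν| ≤ D`,
`|σ(entryVal)| ≤ (D·hdeg + 2k)^k qB^k hB^D ((s+1)M^{s+1})^{D·hdeg + 2k}` for every embedding `σ`, and
`d_s^{2D + 3k + (D·hdeg + 2k)} · entryVal ∈ 𝓞_K`. [cite: BakerWustholz2007, §6.8] -/
theorem entryVal_bounds (σ : B.K →+* ℂ) (s : ℕ) {k : ℕ} (ω : Fin k → Fin B.dd) {D : ℕ}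
    {ν : β ⊕ (γ ⊕ δ) →₀ ℕ} (hν : ν.degree ≤ D) :
    ‖σ (B.entryVal s ω D ν)‖ ≤ (((D * B.hdeg : ℕ) : ℝ) + 2 * k) ^ k * B.qB ^ k * B.hB ^ D *
        ((s + 1) * B.M ^ (s + 1)) ^ (D * B.hdeg + 2 * k) ∧
      B.IntZ ((B.dAt s : B.K) ^ (2 * D + k * 3 + (D * B.hdeg + 2 * k)) * B.entryVal s ω D ν) := by
  obtain ⟨hdegF, hnormF, hdenF⟩ := B.Fν_bounds σ (B.cAt s) hν
  have hq : ∀ m i, wnorm (embSeminorm σ) (B.QK (B.cAt s) m i) ≤ B.qB := fun m i => B.wnorm_QK_le σ _ m i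
  have hQdeg : ∀ m i, (B.QK (B.cAt s) m i).totalDegree ≤ 2 := fun m i => B.totalDegree_QK_le _ m i
  have hdQ : ∀ m i, IsDenInt (B.dAt s) 3 (B.QK (B.cAt s) m i) := fun m i =>
    (B.isDenInt_QK _ m i).of_dvd (B.d₁_dvd_dAt s)
  have hdF : IsDenInt (B.dAt s) (2 * D) (B.Fν (B.cAt s) D ν) := hdenF.of_dvd (B.d₁_dvd_dAt s)
  have hM1 : 1 ≤ (s + 1 : ℝ) * B.M ^ (s + 1) := by
    have hM := B.gens.one_le_M
    have h1 : (1 : ℝ) ≤ s + 1 := by have : (0:ℝ) ≤ s := Nat.cast_nonneg s; linarith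
    exact one_le_mul_of_one_le_of_one_le h1 (one_le_pow₀ hM)
  have hg : ∀ i, ‖σ (B.gK s i)‖ ≤ (s + 1) * B.M ^ (s + 1) := fun i => B.norm_embedding_gK_le σ s i
  have key := ArithPoly.word_eval_bounds σ B.qB_nonneg hq hQdeg hdQ hdegF hnormF hdF
    (fun i => B.isIntegral_dAt_mul_gK s i) hM1 hg ω
  exact key

end BakerData

end Std

end GaGmE

end Literature.NumberTheory.Transcendental

end
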